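import Summits.HodgeConjecture.HodgeConjecture.Theorems.Ring2WeilCoverageCMFieldNormResidueSymbolsSplitRationalPrimes
import Summits.HodgeConjecture.HodgeConjecture.Theorems.Ring2WeilCoverageCMFieldCyclicRootCharacters
import Summits.HodgeConjecture.HodgeConjecture.Theorems.Ring2WeilCoverageCMFieldNormResidueSymbolsInertRationalPrimes
import HarnessLib

/-!
# Ring 2 — Weil-family coverage, CM-field rows: THE COMPLETE RATIONAL PRIME RULE for the cyclic quartic CM fields over
  `F = ℚ(√5)`, I — tools and `ℚ(√-(5+√5))` (conductor `40`)  (WEIL-FAMILY-COVERAGE «## b03», cell (xxi‴), part 24)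

research route conditional on HC_CM; not a corollary; Q11.4-sentence-2 already refuted in dim ≥ 3.

On Deligne's carrier `R = S² + pS + q` (`F = ℚ(θ)`, `E = F(√θ)`, rows `W_{2k}.E.δ`, `δ ∈ F^×/Nm_{E/F}(E^×)` labelled by
`T(δ) = {𝔭 : (δ, θ)_𝔭 = -1}`) [cite: Deligne1982HodgeCycles, §4 p. 30, (1), Cor. 4.2] the class `[ℓ]` of a rational
prime is: non-split for `ℓ` INERT in `F` and prime to `q` (part 21); for `ℓ` SPLIT in `F` decided by the quadratic
character of the roots of `R̄` in `𝔽_ℓ` (part 22), which part 23 computed as a congruence for the cyclic carriers; and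
for the finitely many `ℓ ∣ 2q·disc` decided here at the ramified place `(√5)` (O'Meara 63:11a: `(ℓ, θ)_{(√5)} = -1` iff
`ℓ` is a non-square mod `5`, as `ord_{(√5)} θ = 1`).  Assembled:

* §62 tools: a place over a rational prime; the residue field at an inert radicand prime is `𝔽_{p₀²}` (so every
  integer is a square there); Euler's criterion mod `v` (`z^{(Nv-1)/2} ≡ -1 ⟹ z` non-square); `ord_v θ` is ODD
  when `θ² = p₀·m²` with `m ∉ v ∋ p₀`, `p₀` ramified.
* §63 **`E = ℚ(√-(5+√5))`, `R = S² + 10S + 20`: for EVERY prime `ℓ`, `[ℓ] ≠ [1] ⟺ ℓ ≠ 5 ∧ ℓ mod 40 ∉ {1, 19, 29, 31}`**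
  (`= Gal(ℚ(ζ₄₀)/E)`; `[2] ≠ [1]` at `(√5)`, `[5] = [(√5)²] = [1]`).
The sequel (part 25) does `ℚ(√-3(5+√5)/2)` (conductor `60`) and re-derives `ℚ(ζ₅)` (b03.16) by the same route, so that
the «primes» column of the three `F = ℚ(√5)` cyclic tables is ONE kernel theorem per field, uniform in method with the
fifteen biquadratic tables (parts 16–20).  No new definition, no named fact, no sorry; nothing about the Hodge
conjecture is asserted (index-set bookkeeping of the census only).
-/

noncomputable section

set_option linter.dupNamespace false

open Polynomial NumberField IsDedekindDomain

namespace Summit.HodgeConjecture.HodgeConjecture.Ring2.WeilCoverageCM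

open Literature.AlgebraicGeometry.Deligne1982
open Literature.AlgebraicGeometry.HodgeTheory (splitDiscriminantClassCM)
open Literature.NumberTheory.QuadraticForms

variable {R : Polynomial ℤ} [Fact (Irreducible (cmPolyQ R))] [Fact (Irreducible (realPolyQ R))]

/-! ### §62 Tools: places over a prime, inert radicand primes, Euler's criterion mod `v`, `ord_v θ` at a ramified prime -/

section Tools

omit [Fact (Irreducible (cmPolyQ R))] in
/-- **A place over a rational prime** `p₀` (`(p₀) ≠ (1)` as `N((p₀)) = p₀² ≠ 1`). [folklore] -/
theorem exists_place_natCast_mem (hK : Module.finrank ℚ (realField R) = 2) {p₀ : ℕ} (hp₀ : p₀.Prime) :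
    ∃ v : HeightOneSpectrum (𝓞 (realField R)), (p₀ : 𝓞 (realField R)) ∈ v.asIdeal := by
  have hntop : Ideal.span {(p₀ : 𝓞 (realField R))} ≠ ⊤ := fun h ↦ by
    have := congrArg Ideal.absNorm h
    rw [absNorm_span_natCast, hK, Ideal.absNorm_top] at this
    exact hp₀.one_lt.ne' (by simpa using this)
  obtain ⟨M, hM, hle⟩ := Ideal.exists_le_maximal _ hntop
  have hpM : (p₀ : 𝓞 (realField R)) ∈ M := hle (Ideal.mem_span_singleton_self _)
  have hMbot : M ≠ ⊥ := fun h ↦ by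
    rw [h, Submodule.mem_bot, Nat.cast_eq_zero] at hpM; exact hp₀.ne_zero hpM
  exact ⟨⟨M, hM.isPrime, hMbot⟩, hpM⟩

omit [Fact (Irreducible (cmPolyQ R))] in
/-- **Inert radicand prime: the residue field is `𝔽_{p₀²}`** — if `s² = d` in `𝓞_F` with `d` a non-square mod `p₀`,
then `N v = p₀²` at every `v ∋ p₀` (`N v = p₀` would make `s̄² = d` a square in `𝔽_{p₀}`). [folklore] -/
theorem absNorm_eq_sq_of_inert_radicand (hK : Module.finrank ℚ (realField R) = 2) {s : 𝓞 (realField R)} {d : ℤ}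
    (hs : s ^ 2 = d) {p₀ : ℕ} (hp₀ : p₀.Prime) (hnd : ¬ IsSquare ((d : ℤ) : ZMod p₀))
    (v : HeightOneSpectrum (𝓞 (realField R))) (hpv : (p₀ : 𝓞 (realField R)) ∈ v.asIdeal) :
    Ideal.absNorm v.asIdeal = p₀ ^ 2 := by
  rcases absNorm_eq_or_eq_sq_of_natCast_mem hK v hp₀ hpv with h | h
  · exfalso
    refine hnd ((isSquare_intCast_residue_iff_of_absNorm_eq v hp₀ h d).1 ⟨Ideal.Quotient.mk v.asIdeal s, ?_⟩)
    rw [← map_mul, ← sq, hs]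
  · exact h

omit [Fact (Irreducible (cmPolyQ R))] in
/-- Hence at such a place **every prime `ℓ ≠ p₀` is a `v`-unit and a square mod `v`** (hypothesis `hb` of part 22 at the
inert radicand primes: `(3)` for `ℚ(√5)` and for `ℚ(√2)`). [folklore] -/
theorem natCast_notMem_and_isSquare_of_inert_radicand (hK : Module.finrank ℚ (realField R) = 2)
    {s : 𝓞 (realField R)} {d : ℤ} (hs : s ^ 2 = d) {p₀ : ℕ} (hp₀ : p₀.Prime) (hnd : ¬ IsSquare ((d : ℤ) : ZMod p₀))
    {ℓ : ℕ} (hℓ : ℓ.Prime) (hℓp : ℓ ≠ p₀) (v : HeightOneSpectrum (𝓞 (realField R)))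
    (hpv : (p₀ : 𝓞 (realField R)) ∈ v.asIdeal) :
    (ℓ : 𝓞 (realField R)) ∉ v.asIdeal ∧ IsSquare (Ideal.Quotient.mk v.asIdeal (ℓ : 𝓞 (realField R))) := by
  refine ⟨?_, ?_⟩
  · have hcop : IsCoprime (p₀ : ℤ) ℓ := by
      rw [Int.isCoprime_iff_gcd_eq_one, Int.gcd_natCast_natCast]
      exact (Nat.coprime_primes hp₀ hℓ).2 (Ne.symm hℓp)
    have := intCast_notMem_of_isCoprime v hcop (by push_cast; exact hpv)
    push_cast at this
    exact this
  · have := isSquare_intCast_residue_of_absNorm_eq_sq v hp₀ (absNorm_eq_sq_of_inert_radicand hK hs hp₀ hnd v hpv) ℓ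
    push_cast at this
    exact this

omit [Fact (Irreducible (cmPolyQ R))] in
/-- **Euler's criterion mod `v` (easy half).** At a non-dyadic place `v` with `N v = 2n + 1`: if `z^n ≡ -1 (mod v)` then
`z` is a NON-square mod `v` (`z ≡ y²` would give `-1 ≡ y^{2n} = y^{Nv - 1} ≡ 1`). [folklore] -/
theorem not_isSquare_residue_of_pow_add_one_mem (v : HeightOneSpectrum (𝓞 (realField R)))
    (h2 : (2 : 𝓞 (realField R)) ∉ v.asIdeal) {n : ℕ} (hN : Ideal.absNorm v.asIdeal = 2 * n + 1)
    {z : 𝓞 (realField R)} (hz : z ^ n + 1 ∈ v.asIdeal) : ¬ IsSquare (Ideal.Quotient.mk v.asIdeal z) := by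
  classical
  haveI : v.asIdeal.IsPrime := v.isPrime
  haveI : Finite (𝓞 (realField R) ⧸ v.asIdeal) := v.asIdeal.finiteQuotientOfFreeOfNeBot v.ne_bot
  letI : Fintype (𝓞 (realField R) ⧸ v.asIdeal) := Fintype.ofFinite _
  have hcard : Fintype.card (𝓞 (realField R) ⧸ v.asIdeal) = 2 * n + 1 := by rw [card_quotient_eq_absNorm, hN]
  rintro ⟨y, hy⟩
  have hzn : (Ideal.Quotient.mk v.asIdeal z) ^ n = -1 := by
    have h := (Ideal.Quotient.eq_zero_iff_mem).2 hz
    rw [map_add, map_pow, map_one] at h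
    exact eq_neg_of_add_eq_zero_left h
  have hy0 : y ≠ 0 := fun h0 ↦ by
    rw [h0, mul_zero] at hy
    rw [hy] at hzn
    rcases Nat.eq_zero_or_pos n with hn | hn
    · -- `N v = 1` is impossible
      exact absNorm_asIdeal_ne_one v (by rw [hN, hn])
    · rw [zero_pow hn.ne'] at hzn
      have h1 : (1 : 𝓞 (realField R) ⧸ v.asIdeal) = 0 := by
        have := congrArg (fun t ↦ -t) hzn; simpa using this.symm
      exact h2 ((Ideal.Quotient.eq_zero_iff_mem).1 (by rw [show (2 : 𝓞 (realField R)) = 1 + 1 by norm_num, map_add,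
        map_one, h1, add_zero]))
  have hfermat : y ^ (2 * n) = 1 := by
    haveI : v.asIdeal.IsMaximal := v.isMaximal
    letI : Field (𝓞 (realField R) ⧸ v.asIdeal) := Ideal.Quotient.field v.asIdeal
    have h := FiniteField.pow_card_sub_one_eq_one y hy0
    rwa [hcard, Nat.add_sub_cancel] at h
  have hcontra : (-1 : 𝓞 (realField R) ⧸ v.asIdeal) = 1 := by
    rw [← hzn, hy, ← hfermat]; ring
  refine h2 ((Ideal.Quotient.eq_zero_iff_mem).1 ?_)
  rw [map_ofNat]
  linear_combination -hcontra

omit [Fact (Irreducible (cmPolyQ R))] in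
/-- **`ord_v θ` is ODD at a ramified radicand prime**: if `π² = p₀·w`, `a p₀ + b w = 1` (so `ord_v p₀ = 2` at the place
`v ∋ p₀`, part 13) and `θ² = p₀·m²` with `m ∉ v`, then `ord_v θ = 1`. [folklore] -/
theorem odd_log_valuation_of_sq_eq_prime_mul_sq (hK : Module.finrank ℚ (realField R) = 2) {p₀ : ℕ} (hp₀ : p₀.Prime)
    {π w a b : 𝓞 (realField R)} (hπ : π ^ 2 = p₀ * w) (hab : a * p₀ + b * w = 1)
    (v : HeightOneSpectrum (𝓞 (realField R))) (hpv : (p₀ : 𝓞 (realField R)) ∈ v.asIdeal)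
    {θₒ m : 𝓞 (realField R)} (hθm : θₒ ^ 2 = p₀ * m ^ 2) (hm : m ∉ v.asIdeal) :
    Odd (WithZero.log (v.valuation (realField R) ((θₒ : 𝓞 (realField R)) : realField R))) := by
  have hp2 := log_valuation_eq_neg_two_of_sq_eq_mul hK hp₀ hπ hab v hpv
  have hm0 := log_valuation_coe_eq_zero_of_notMem v hm
  have hmne : ((m : 𝓞 (realField R)) : realField R) ≠ 0 := fun h ↦ hm (by
    rw [show m = 0 from RingOfIntegers.coe_injective (by simpa using h)]; exact v.asIdeal.zero_mem)
  have hpne : (p₀ : realField R) ≠ 0 := by exact_mod_cast hp₀.ne_zero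
  have hθne : ((θₒ : 𝓞 (realField R)) : realField R) ≠ 0 := fun h ↦ by
    have h0 : θₒ = 0 := RingOfIntegers.coe_injective (by simpa using h)
    rw [h0, zero_pow two_ne_zero] at hθm
    have : (m : 𝓞 (realField R)) ^ 2 = 0 := by
      rcases mul_eq_zero.1 hθm.symm with h | h
      · exact absurd h (by exact_mod_cast hp₀.ne_zero)
      · exact h
    exact hmne (by rw [show m = 0 from pow_eq_zero_iff (n := 2) two_ne_zero |>.1 this]; rfl)
  have e : ((θₒ : 𝓞 (realField R)) : realField R) ^ 2 = (p₀ : realField R) * ((m : 𝓞 (realField R)) : realField R) ^ 2 := by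
    have h := congrArg (algebraMap (𝓞 (realField R)) (realField R)) hθm
    rw [map_pow, map_mul, map_pow, map_natCast] at h
    exact h
  have hv := congrArg (fun t ↦ WithZero.log (v.valuation (realField R) t)) e
  simp only [map_pow, map_mul] at hv
  rw [WithZero.log_pow, WithZero.log_mul (by exact (Valuation.ne_zero_iff _).2 hpne)
      (pow_ne_zero _ ((Valuation.ne_zero_iff _).2 hmne)), WithZero.log_pow, hp2, hm0] at hv
  simp only [nsmul_eq_mul, Nat.cast_ofNat, mul_zero, add_zero] at hv
  have : WithZero.log (v.valuation (realField R) ((θₒ : 𝓞 (realField R)) : realField R)) = -1 := by omega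
  rw [this]; decide

/-- **`[x²] = [1]`**: a non-zero square of `F` is in the split class (`x² = x² - θ·0²`). [cite: Deligne1982HodgeCycles, §4 Cor. 4.2] -/
theorem mk_eq_splitDiscriminantClassCM_of_eq_sq (qℓ : (realField R)ˣ) {x : realField R}
    (h : (qℓ : realField R) = x ^ 2) {k : ℕ} (hk : Even k) :
    (QuotientGroup.mk qℓ : cmNormResidueGroup R) = splitDiscriminantClassCM R k :=
  mk_eq_splitDiscriminantClassCM_of_eq_sq_sub_mul_sq (c := 1) (b := AdjoinRoot.root (realPolyQ R)) (by ring) qℓ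
    (x := x) (y := 0) (by rw [h]; ring) hk

/-- **`[p₀] ≠ [1]` read at the ramified place `(√p₀)`-type place `v`**: `θ = 1²·θ`, `p₀' ∈ ℕ` a prime `≠ p₀` which is a
`v`-unit NON-square mod `v`, and `ord_v θ` odd ⟹ `[p₀'] ≠ [(-1)^k]` (`k` even) (O'Meara 63:11a, part 22 §55).
[cite: Deligne1982HodgeCycles, §4 (1) and Cor. 4.2] [cite: Omeara1963, §63B Cor. 63:11a] -/
theorem mk_natCast_ne_splitDiscriminantClassCM_of_ramified_place {θₒ : 𝓞 (realField R)}
    (hθ : (θₒ : realField R) = AdjoinRoot.root (realPolyQ R)) (v : HeightOneSpectrum (𝓞 (realField R)))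
    (h2 : (2 : 𝓞 (realField R)) ∉ v.asIdeal) {ℓ : ℕ} (hℓv : (ℓ : 𝓞 (realField R)) ∉ v.asIdeal)
    (hns : ¬ IsSquare (Ideal.Quotient.mk v.asIdeal (ℓ : 𝓞 (realField R))))
    (hodd : Odd (WithZero.log (v.valuation (realField R) ((θₒ : 𝓞 (realField R)) : realField R))))
    (qℓ : (realField R)ˣ) (hq : (qℓ : realField R) = ℓ) {k : ℕ} (hk : Even k) :
    (QuotientGroup.mk qℓ : cmNormResidueGroup R) ≠ splitDiscriminantClassCM R k :=
  mk_coe_ne_splitDiscriminantClassCM_of_notMem (c := 1) (b := θₒ) (by rw [one_pow, one_mul, hθ]) v h2 hℓv hns hodd qℓ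
    (by rw [hq]; exact (map_natCast (algebraMap (𝓞 (realField R)) (realField R)) ℓ).symm) hk

end Tools

/-! ### §63 `E = ℚ(√-(5+√5))` (`R = S² + 10S + 20`, `F = ℚ(√5)`, `θ = -√5·(1+√5)`, conductor `40`):
  `[ℓ] ≠ [1] ⟺ ℓ ≠ 5 ∧ ℓ mod 40 ∉ {1, 19, 29, 31}` -/

section Cond40

omit [Fact (Irreducible (cmPolyQ R))] in
/-- `√5 = -(θ + 5)` is an algebraic integer of `F` with square `5`. [folklore] -/
theorem sqrtNegFivePlusSqrtFive_ratPrimeRule_exists_sq_eq_five (hR : R = X ^ 2 + C 10 * X + C 20) :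
    ∃ s : 𝓞 (realField R), (s : realField R) = -(AdjoinRoot.root (realPolyQ R) + 5) ∧ s ^ 2 = 5 := by
  have hrel := root_rel_quadratic hR
  push_cast at hrel
  have hsq : (-(AdjoinRoot.root (realPolyQ R) + 5)) ^ 2 = (5 : realField R) := by linear_combination hrel
  have hint : IsIntegral ℤ (-(AdjoinRoot.root (realPolyQ R) + 5) : realField R) := by
    refine ⟨X ^ 2 - C 5, by monicity!, ?_⟩
    rw [eval₂_sub, eval₂_X_pow, eval₂_C]
    simp only [eq_intCast, Int.cast_ofNat]
    linear_combination hsq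
  refine ⟨⟨_, hint⟩, rfl, ?_⟩
  refine RingOfIntegers.ext ?_
  simp only [map_pow, map_ofNat]
  exact hsq

omit [Fact (Irreducible (cmPolyQ R))] in
/-- The golden integer `ω = (1 + √5)/2 = -(θ + 4)/2 ∈ 𝓞_F`: `ω² = ω + 1`. [folklore] -/
theorem sqrtNegFivePlusSqrtFive_ratPrimeRule_exists_golden (hR : R = X ^ 2 + C 10 * X + C 20) :
    ∃ s : 𝓞 (realField R), (s : realField R) = -(AdjoinRoot.root (realPolyQ R) + 4) / 2 ∧ s ^ 2 = s + 1 := by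
  have hrel := root_rel_quadratic hR
  push_cast at hrel
  have hsq : (-(AdjoinRoot.root (realPolyQ R) + 4) / 2) ^ 2 = -(AdjoinRoot.root (realPolyQ R) + 4) / 2 + (1 : realField R) := by
    linear_combination (1 / 4 : realField R) * hrel
  have hint : IsIntegral ℤ (-(AdjoinRoot.root (realPolyQ R) + 4) / 2 : realField R) := by
    refine ⟨X ^ 2 - X - C 1, by monicity!, ?_⟩
    rw [eval₂_sub, eval₂_sub, eval₂_X_pow, eval₂_X, eval₂_C]
    simp only [eq_intCast, Int.cast_one]
    linear_combination hsq
  refine ⟨⟨_, hint⟩, rfl, ?_⟩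
  refine RingOfIntegers.ext ?_
  simp only [map_pow, map_add, map_one]
  exact hsq

omit [Fact (Irreducible (cmPolyQ R))] in
/-- **`F = ℚ(√5)` has exactly one dyadic place** (in this carrier's terms). [folklore] -/
theorem sqrtNegFivePlusSqrtFive_ratPrimeRule_dyadic_unique (hR : R = X ^ 2 + C 10 * X + C 20)
    (v v' : HeightOneSpectrum (𝓞 (realField R))) (h2 : (2 : 𝓞 (realField R)) ∈ v.asIdeal)
    (h2' : (2 : 𝓞 (realField R)) ∈ v'.asIdeal) : v = v' := by
  obtain ⟨s, -, hs⟩ := sqrtNegFivePlusSqrtFive_ratPrimeRule_exists_golden hR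
  have hx : ∀ w : HeightOneSpectrum (𝓞 (realField R)), s ^ 2 - s ∉ w.asIdeal := fun w h ↦
    w.isPrime.ne_top ((Ideal.eq_top_iff_one _).2 (by rwa [show s ^ 2 - s = 1 by rw [hs]; ring] at h))
  exact dyadic_unique_of_sq_sub_self_notMem (finrank_realField_quadratic hR) v v' h2 h2' (hx v) (hx v')

omit [Fact (Irreducible (cmPolyQ R))] in
/-- **The odd places of `θ` are harmless for a prime `ℓ` which is a square mod `5`** (`θ ∈ v ∌ 2 ⟹ 20 ∈ v ⟹ 5 ∈ v`,
and at `v = (√5)` the prime `ℓ ≠ 5` is a unit, a square mod `v` iff mod `5`). [folklore] -/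
theorem sqrtNegFivePlusSqrtFive_ratPrimeRule_root_places (hR : R = X ^ 2 + C 10 * X + C 20)
    {θₒ : 𝓞 (realField R)} (hθ : (θₒ : realField R) = AdjoinRoot.root (realPolyQ R)) {ℓ : ℕ} (hℓ : ℓ.Prime)
    (hℓ5 : ℓ ≠ 5) (hsq : IsSquare ((ℓ : ℤ) : ZMod 5)) :
    ∀ v : HeightOneSpectrum (𝓞 (realField R)), (2 : 𝓞 (realField R)) ∉ v.asIdeal → θₒ ∈ v.asIdeal →
      (ℓ : 𝓞 (realField R)) ∉ v.asIdeal ∧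
        (IsSquare (Ideal.Quotient.mk v.asIdeal (ℓ : 𝓞 (realField R))) ∨
          ¬ Odd (WithZero.log (v.valuation (realField R) ((θₒ : 𝓞 (realField R)) : realField R)))) := by
  intro v h2 hθv
  have h20 : ((20 : ℤ) : 𝓞 (realField R)) ∈ v.asIdeal := intCast_mem_of_root_mem hR hθ v hθv
  have h5v : (5 : 𝓞 (realField R)) ∈ v.asIdeal := by
    have e : ((20 : ℤ) : 𝓞 (realField R)) = 2 * (2 * 5) := by push_cast; norm_num
    rw [e] at h20
    rcases v.isPrime.mem_or_mem h20 with h | h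
    · exact absurd h h2
    · exact (v.isPrime.mem_or_mem h).resolve_left h2
  obtain ⟨hℓv, hsqv⟩ := radicand_places_of_isSquare_mod (finrank_realField_quadratic hR) Nat.prime_five hℓ hℓ5 hsq v
    (by exact_mod_cast h5v)
  exact ⟨hℓv, Or.inl hsqv⟩

/-- **`[5] = [1]`** for `ℚ(√-(5+√5))`: `5 = (θ + 5)²` is a square in `F`. [cite: Deligne1982HodgeCycles, §4 Cor. 4.2] -/
theorem sqrtNegFivePlusSqrtFive_ratPrimeRule_mk_five_eq_splitDiscriminantClassCM (hR : R = X ^ 2 + C 10 * X + C 20)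
    (qℓ : (realField R)ˣ) (hq : (qℓ : realField R) = 5) {k : ℕ} (hk : Even k) :
    (QuotientGroup.mk qℓ : cmNormResidueGroup R) = splitDiscriminantClassCM R k := by
  have hrel := root_rel_quadratic hR
  push_cast at hrel
  exact mk_eq_splitDiscriminantClassCM_of_eq_sq qℓ (x := AdjoinRoot.root (realPolyQ R) + 5)
    (by rw [hq]; linear_combination -hrel) hk

/-- **`[2] ≠ [1]`** for `ℚ(√-(5+√5))`, read at the ramified place `v = (√5)`: `2` is a `v`-unit and a non-square mod
`v` (`𝓞_F/v = 𝔽₅`), and `ord_v θ = 1` (`θ² = 5·(θ + 4)²`, `(θ+4)(-θ-6) = -4 ∉ v`). [cite: Deligne1982HodgeCycles, §4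
(1) and Cor. 4.2] [cite: Omeara1963, §63B Cor. 63:11a] -/
theorem sqrtNegFivePlusSqrtFive_ratPrimeRule_mk_two_ne_splitDiscriminantClassCM (hR : R = X ^ 2 + C 10 * X + C 20)
    (qℓ : (realField R)ˣ) (hq : (qℓ : realField R) = 2) {k : ℕ} (hk : Even k) :
    (QuotientGroup.mk qℓ : cmNormResidueGroup R) ≠ splitDiscriminantClassCM R k := by
  have hK := finrank_realField_quadratic hR
  have hnsq : ¬ IsSquare (((2 : ℕ) : ℤ) : ZMod 5) := by decide
  obtain ⟨hRm, -⟩ := monic_and_natDegree_of_quadratic R hR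
  obtain ⟨θₒ, hθ⟩ := exists_ringOfIntegers_coe_eq_root hRm
  have hrel := ringOfIntegers_root_rel_quadratic hR hθ
  push_cast at hrel
  obtain ⟨s, -, hs⟩ := sqrtNegFivePlusSqrtFive_ratPrimeRule_exists_sq_eq_five hR
  have hs' : s ^ 2 = (5 : ℕ) * 1 := by rw [hs]; norm_num
  have hab : (0 : 𝓞 (realField R)) * (5 : ℕ) + 1 * 1 = 1 := by norm_num
  obtain ⟨v, h5v⟩ := exists_place_natCast_mem hK Nat.prime_five
  have hN := absNorm_eq_of_sq_eq_mul hK Nat.prime_five hs' hab v h5v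
  have h5v' : ((5 : ℤ) : 𝓞 (realField R)) ∈ v.asIdeal := by exact_mod_cast h5v
  have h2v : (2 : 𝓞 (realField R)) ∉ v.asIdeal := by
    have := intCast_notMem_of_isCoprime v (show IsCoprime (5 : ℤ) 2 by norm_num) h5v'
    exact_mod_cast this
  have hm : θₒ + 4 ∉ v.asIdeal := fun h ↦ by
    have h4 : ((4 : ℤ) : 𝓞 (realField R)) ∈ v.asIdeal := by
      have e : ((4 : ℤ) : 𝓞 (realField R)) = -((θₒ + 4) * (-θₒ - 6)) + -(θₒ ^ 2 + 10 * θₒ + 20) := by push_cast; ring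
      rw [e, hrel, neg_zero, add_zero]
      exact v.asIdeal.neg_mem (v.asIdeal.mul_mem_right _ h)
    exact intCast_notMem_of_isCoprime v (show IsCoprime (5 : ℤ) 4 by norm_num) h5v' h4
  have hθm : θₒ ^ 2 = (5 : ℕ) * (θₒ + 4) ^ 2 := by push_cast; linear_combination (-4 : 𝓞 (realField R)) * hrel
  have hodd := odd_log_valuation_of_sq_eq_prime_mul_sq hK Nat.prime_five hs' hab v h5v hθm hm
  refine mk_natCast_ne_splitDiscriminantClassCM_of_ramified_place hθ v h2v (ℓ := 2) (by exact_mod_cast h2v) ?_ hodd qℓ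
    (by rw [hq]; norm_num) hk
  have := (isSquare_intCast_residue_iff_of_absNorm_eq v Nat.prime_five hN 2).not.2 hnsq
  push_cast at this
  exact this

/-- **THE RATIONAL PRIME RULE for `ℚ(√-(5+√5))`** (conductor `40`): for EVERY rational prime `ℓ` and even `k`, the row
`W_{2k}.E.[ℓ]` is non-split iff **`ℓ ≠ 5` and `ℓ mod 40 ∉ {1, 19, 29, 31}`** — the norm primes are `5 = (√5)²` and the
primes in `H = Gal(ℚ(ζ₄₀)/E) = {1, 19, 29, 31} ⊂ (ℤ/40)^×` (totally split in `E`); the inert primes `ℓ ≡ ±2 (mod 5)`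
(part 21) and the split primes with `(2|ℓ)·ε₅(ℓ) = -1` (parts 22–23) are non-norms.
[cite: Deligne1982HodgeCycles, §4 (1) and Cor. 4.2] [cite: Omeara1963, §63B Example 63:12 and §71D Thm. 71:18] -/
theorem sqrtNegFivePlusSqrtFive_mk_prime_ne_splitDiscriminantClassCM_iff_mod (hR : R = X ^ 2 + C 10 * X + C 20)
    {ℓ : ℕ} (hℓ : ℓ.Prime) (qℓ : (realField R)ˣ) (hq : (qℓ : realField R) = ℓ) {k : ℕ} (hk : Even k) :
    (QuotientGroup.mk qℓ : cmNormResidueGroup R) ≠ splitDiscriminantClassCM R k ↔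
      ℓ ≠ 5 ∧ ¬ (ℓ % 40 = 1 ∨ ℓ % 40 = 19 ∨ ℓ % 40 = 29 ∨ ℓ % 40 = 31) := by
  by_cases h2 : ℓ = 2
  · subst h2
    exact iff_of_true (sqrtNegFivePlusSqrtFive_ratPrimeRule_mk_two_ne_splitDiscriminantClassCM hR qℓ (by rw [hq]; norm_num) hk)
      ⟨by omega, by omega⟩
  by_cases h5 : ℓ = 5
  · subst h5
    exact iff_of_false (not_not.2 (sqrtNegFivePlusSqrtFive_ratPrimeRule_mk_five_eq_splitDiscriminantClassCM hR qℓ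
      (by rw [hq]; norm_num) hk)) (fun h ↦ h.1 rfl)
  by_cases hin : ℓ % 5 = 2 ∨ ℓ % 5 = 3
  · exact iff_of_true (sqrtNegFivePlusSqrtFive_ratPrimeRule_mk_prime_ne_splitDiscriminantClassCM_of_inert hR hℓ h2 hin qℓ hq k)
      ⟨h5, by omega⟩
  -- `ℓ` splits in `F`: `ℓ ≡ ±1 (mod 5)`
  have h5' : ℓ % 5 ≠ 0 := fun h ↦ h5 ((Nat.prime_dvd_prime_iff_eq Nat.prime_five hℓ).1 (Nat.dvd_of_mod_eq_zero h)).symm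
  have hsp : ℓ % 5 = 1 ∨ ℓ % 5 = 4 := by omega
  have hsq5 : IsSquare ((ℓ : ℤ) : ZMod 5) := by
    have sq1 : IsSquare ((1 : ℕ) : ZMod 5) := by decide
    have sq4 : IsSquare ((4 : ℕ) : ZMod 5) := by decide
    rw [Int.cast_natCast, ← ZMod.natCast_mod ℓ 5]
    rcases hsp with h | h <;> rw [h]
    · exact sq1
    · exact sq4
  haveI := Fact.mk hℓ
  obtain ⟨hRm, -⟩ := monic_and_natDegree_of_quadratic R hR
  obtain ⟨θₒ, hθ⟩ := exists_ringOfIntegers_coe_eq_root hRm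
  have hroots := roots_real_neg_of_quadratic hR (by norm_num) (by norm_num) (by norm_num)
  have hdisc : ¬ (ℓ : ℤ) ∣ (10 : ℤ) ^ 2 - 4 * 20 := fun h ↦ by
    have h' : ℓ ∣ 2 ^ 2 * 3 ^ 0 * 5 ^ 1 := by norm_num at h ⊢; exact_mod_cast h
    rcases eq_of_prime_dvd_two_pow_mul hℓ h' with rfl | rfl | rfl <;> omega
  have hℓq : ¬ (ℓ : ℤ) ∣ (20 : ℤ) := fun h ↦ by
    have h' : ℓ ∣ 2 ^ 2 * 3 ^ 0 * 5 ^ 1 := by norm_num; exact_mod_cast h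
    rcases eq_of_prime_dvd_two_pow_mul hℓ h' with rfl | rfl | rfl <;> omega
  have h20 : (2 : ZMod ℓ) ≠ 0 := by exact_mod_cast natCast_prime_ne_zero_zmod Nat.prime_two h2
  have hdsq : IsSquare (((10 : ℤ) ^ 2 - 4 * 20 : ℤ) : ZMod ℓ) := by
    push_cast
    rw [show (20 : ZMod ℓ) = 5 * 2 ^ 2 by norm_num, isSquare_mul_sq_iff_of_ne_zero h20, isSquare_five_iff h2 h5]
    exact hsp
  rw [mk_natCast_ne_splitDiscriminantClassCM_iff_of_root_character hR hroots hθ (sqrtNegFivePlusSqrtFive_ratPrimeRule_dyadic_unique hR)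
    hℓ h2 hℓq hdisc hdsq (sqrtNegFivePlusSqrtFive_ratPrimeRule_root_places hR hθ hℓ h5 hsq5)
    (fun r hr ↦ isSquare_root_iff_cond40 h2 h5 r (by push_cast at hr; exact hr)) qℓ hq hk]
  have hodd : ℓ % 2 = 1 := (Nat.Prime.mod_two_eq_one_iff_ne_two hℓ).2 h2
  have key : ∀ n : ℕ, n % 2 = 1 → (n % 5 = 1 ∨ n % 5 = 4) →
      (¬ ((n % 8 = 1 ∨ n % 8 = 7) ↔ n % 5 = 1) ↔ (n ≠ 5 ∧ ¬ (n % 40 = 1 ∨ n % 40 = 19 ∨ n % 40 = 29 ∨ n % 40 = 31))) := by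
    intro n hn0 hn1
    obtain ⟨k', r, hr, rfl⟩ : ∃ k' r, r < 40 ∧ n = 40 * k' + r :=
      ⟨n / 40, n % 40, Nat.mod_lt _ (by norm_num), (Nat.div_add_mod n 40).symm⟩
    interval_cases r <;> omega
  exact key ℓ hodd hsp

/-- Equivalently: **`[ℓ] = [1] ⟺ ℓ = 5 ∨ ℓ mod 40 ∈ {1, 19, 29, 31}`** (`ℚ(√-(5+√5))`, every prime `ℓ`, even `k`).
[cite: Deligne1982HodgeCycles, §4 (1) and Cor. 4.2] -/
theorem sqrtNegFivePlusSqrtFive_mk_prime_eq_splitDiscriminantClassCM_iff_mod (hR : R = X ^ 2 + C 10 * X + C 20)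
    {ℓ : ℕ} (hℓ : ℓ.Prime) (qℓ : (realField R)ˣ) (hq : (qℓ : realField R) = ℓ) {k : ℕ} (hk : Even k) :
    (QuotientGroup.mk qℓ : cmNormResidueGroup R) = splitDiscriminantClassCM R k ↔
      ℓ = 5 ∨ (ℓ % 40 = 1 ∨ ℓ % 40 = 19 ∨ ℓ % 40 = 29 ∨ ℓ % 40 = 31) := by
  have h := sqrtNegFivePlusSqrtFive_mk_prime_ne_splitDiscriminantClassCM_iff_mod hR hℓ qℓ hq hk
  tauto

end Cond40

end Summit.HodgeConjecture.HodgeConjecture.Ring2.WeilCoverageCM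

end
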